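import Mathlib
import Summits.CriticalPhenomena.Ising3DConformalLimit.Theorems.ModularQuarterTurnQuarterTurnAnchorsCorner
import HarnessLib

/-!
# `QuarterTurnAnchors`, III: gluing the four quadrants — the corner-transfer-matrix trace formula
# (route `ModularQuarterTurn`, item stmt-CriticalPhenomena-6495)

Box configurations correspond bijectively to compatible quadruples of quadrant configurations
(`quadRes` / `glue4`), the Boltzmann weight is the product of the four corner weights, and therefore
`∑_τ w(τ) F((ω∘Rᵏ)|_P)_k = ∑_s (∏_k ctm (s k) (s (k+1))) F s` for every function `F` of the four wall
configurations (Baxter 1976).  Plus two algebraic helpers (sums over `Fin 4 → α`; the trace of a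
four-cycle `Tr (D₀ N D₁ N D₂ N D₃ N)`) and two measurability helpers.
-/

namespace Summit.CriticalPhenomena.Ising3DConformalLimit.QuarterTurnCTM

open Literature.Probability.LatticeModels Finset
open scoped Matrix

section

variable (L : ℕ) (β : ℝ)

/-- Successor in `Fin 4` as a residue. [folklore] -/
theorem coe_fin_add_one (k : Fin 4) : (((k + 1 : Fin 4) : ℕ)) = ((k : ℕ) + 1) % 4 := by
  rw [Fin.val_add]; rfl

/-- The quadrant configurations of a box configuration are compatible. [folklore] -/
theorem quadRes_mem_compatSet (τ : ↥(box 3 L) → ℤˣ) : (fun k : Fin 4 => quadRes L k τ) ∈ compatSet L := by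
  rw [mem_compatSet]
  intro k
  funext x
  simp only [resA, resB, quadRes]
  rw [coe_fin_add_one, rotR_iterate_mod_four, Function.iterate_succ_apply]

/-- Gluing back the quadrant configurations of `τ` returns `τ`. [folklore] -/
theorem glue4_quadRes (τ : ↥(box 3 L) → ℤˣ) : glue4 L (fun k : Fin 4 => quadRes L k τ) = τ := by
  funext y
  simp only [glue4, quadRes]
  rw [rotR_iterate_sector_back, glue_apply_of_mem _ _ _ y.2]

/-- Transfer along a compatible quadruple: if `x` and `Rᵐ x` both lie in the quadrant then
`κ (k + m) x = κ k (Rᵐ x)` (the cases `m = 1, 2, 3` are: `x` on the wall `P`, on the hinge, on the wall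
`R P`). [folklore] -/
theorem compat_transfer {κ : Fin 4 → (↥(quadQ L) → ℤˣ)} (hκ : κ ∈ compatSet L) (m : ℕ) (hm : m < 4)
    (k : Fin 4) (x : ↥(quadQ L)) (hx' : rotR^[m] x.1 ∈ quadQ L) :
    κ (k + ⟨m, hm⟩) x = κ k ⟨rotR^[m] x.1, hx'⟩ := by
  rw [mem_compatSet] at hκ
  have hc : ∀ (j : Fin 4) (p : Site 3) (hp : p ∈ wallP L),
      κ j ⟨rotR p, rotR_mem_quadQ_of_mem_wallP hp⟩ = κ (j + 1) ⟨p, wallP_subset_quadQ L hp⟩ :=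
    fun j p hp => congrFun (hκ j) ⟨p, hp⟩
  interval_cases m
  · have h0 : (⟨0, hm⟩ : Fin 4) = 0 := rfl
    rw [h0, add_zero]
    rfl
  · have h1 : (⟨1, hm⟩ : Fin 4) = 1 := rfl
    have hxP : x.1 ∈ wallP L := mem_wallP_of_rotR_mem_quadQ x.2 hx'
    rw [h1, ← hc k x.1 hxP]
    rfl
  · have h2 : (⟨2, hm⟩ : Fin 4) = 1 + 1 := rfl
    have hRx : rotR x.1 = x.1 := rotR_eq_self_of_rotR_rotR_mem_quadQ x.2 hx'
    have hxP : x.1 ∈ wallP L := mem_wallP_of_rotR_mem_quadQ x.2 (by rw [hRx]; exact x.2)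
    have e1 := hc k x.1 hxP
    have e2 := hc (k + 1) x.1 hxP
    simp only [hRx] at e1 e2
    rw [h2, ← add_assoc, ← e2, ← e1]
    congr 1
    apply Subtype.ext
    show x.1 = rotR (rotR x.1)
    rw [hRx, hRx]
  · have h3 : (⟨3, hm⟩ : Fin 4) = 1 + 1 + 1 := rfl
    have hpP : rotR^[3] x.1 ∈ wallP L := rotR_three_mem_wallP x.2 hx'
    have e := hc (k + ⟨3, hm⟩) (rotR^[3] x.1) hpP
    have hk : k + ⟨3, hm⟩ + 1 = k := by
      rw [add_assoc]; exact add_eq_left.2 rfl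
    rw [hk] at e
    rw [← e]
    congr 1
    apply Subtype.ext
    exact (rotR_rotR_three x.1).symm

/-- Reading off the quadrant configurations of a glued compatible quadruple returns the quadruple.
[folklore] -/
theorem quadRes_glue4 {κ : Fin 4 → (↥(quadQ L) → ℤˣ)} (hκ : κ ∈ compatSet L) (k : Fin 4) :
    quadRes L k (glue4 L κ) = κ k := by
  funext x
  have hy : rotR^[k] x.1 ∈ box 3 L := (rotR_iterate_mem_box_iff _ _).2 (quadQ_subset_box L x.2)
  simp only [quadRes]
  rw [glue_apply_of_mem _ _ _ hy]
  simp only [glue4]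
  -- `y = Rᵏ x` lies in sector `j` with representative `b`, `Rʲ b = y`; transfer from `b` back to `x`
  set y := rotR^[k] x.1 with hy_def
  set j := sector y with hj
  have hjlt : j < 4 := sector_lt_four y
  have hb : back y ∈ quadQ L := back_mem_quadQ hy
  have hRb : rotR^[j] (back y) = y := rotR_iterate_sector_back y
  set m := ((4 - (k : ℕ)) + j) % 4 with hm
  have hmlt : m < 4 := Nat.mod_lt _ (by norm_num)
  have hRm : rotR^[m] (back y) = x.1 := by
    rw [hm, rotR_iterate_mod_four, Function.iterate_add_apply, hRb, hy_def,
      ← Function.iterate_add_apply, show 4 - (k : ℕ) + k = 4 by have := k.2; omega, rotR_iterate_four]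
  have key := compat_transfer L hκ m hmlt k ⟨back y, hb⟩ (by rw [hRm]; exact x.2)
  have hidx : k + ⟨m, hmlt⟩ = ⟨j, hjlt⟩ := by
    apply Fin.ext
    rw [Fin.val_add]
    simp only [hm]
    have := k.2
    omega
  rw [hidx] at key
  rw [key]
  congr 1
  exact Subtype.ext hRm

/-- **Box configurations ↔ compatible quadruples of quadrant configurations**: sums over box
configurations may be computed over compatible quadruples. [folklore] -/
theorem sum_eq_sum_compatSet (Φ : (Fin 4 → (↥(quadQ L) → ℤˣ)) → ℝ) :
    ∑ τ : ↥(box 3 L) → ℤˣ, Φ (fun k : Fin 4 => quadRes L k τ) = ∑ κ ∈ compatSet L, Φ κ :=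
  Finset.sum_nbij' (fun τ => fun k : Fin 4 => quadRes L k τ) (glue4 L)
    (fun τ _ => quadRes_mem_compatSet L τ) (fun _ _ => Finset.mem_univ _)
    (fun τ _ => glue4_quadRes L τ) (fun _ hκ => funext fun k => quadRes_glue4 L hκ k)
    (fun _ _ => rfl)

/-- For the `+` boundary condition the interacting bonds are the bonds touching the volume (Friedli–Velenik 2017, §3.1, `ℰ_Λ^b`). [folklore] -/
theorem interactionEdges_plus (Λ : Finset (Site 3)) :
    interactionEdges (zdGraph 3) Λ .plus = edgesTouching (zdGraph 3) Λ := rfl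

/-- **The Boltzmann weight of the box is the product of the four corner weights** of its quadrant
configurations (zero field, `+` boundary condition). [folklore] -/
theorem isingWeight_eq_prod_quadWeight (τ : ↥(box 3 L) → ℤˣ) :
    isingWeight (zdGraph 3) (box 3 L) β 0 .plus τ = ∏ k : Fin 4, quadWeight L β (quadRes L k τ) := by
  rw [isingWeight, isingHamiltonian, interactionEdges_plus, zero_mul, sub_zero, mul_neg, neg_mul,
    neg_neg, sum_bondSpin_eq_sum_hQ, Finset.mul_sum, Real.exp_sum]
  refine Finset.prod_congr rfl fun k _ => ?_
  rw [quadWeight]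
  congr 2
  refine hQ_congr L (fun v hv => ?_) (fun v hv => ?_)
  · have hvQ : v ∉ quadQ L := fun h => hv (quadQ_subset_box L h)
    rw [Function.comp_apply, glue_apply_of_notMem _ _ _ hvQ,
      glue_apply_of_notMem _ _ _ (fun h => hv ((rotR_iterate_mem_box_iff _ _).1 h))]
    rfl
  · rw [Function.comp_apply, glue_apply_of_mem _ _ _ hv]
    rfl

/-- Collapsing the wall sums against the constraints of one quadruple of quadrant configurations.
[folklore] -/
theorem sum_prod_ite_mul (κ : Fin 4 → (↥(quadQ L) → ℤˣ)) (F : (Fin 4 → (↥(wallP L) → ℤˣ)) → ℝ) :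
    ∑ s : Fin 4 → (↥(wallP L) → ℤˣ),
      (∏ k, if resA L (κ k) = s k ∧ resB L (κ k) = s (k + 1) then quadWeight L β (κ k) else 0) * F s =
    if (∀ k : Fin 4, resB L (κ k) = resA L (κ (k + 1))) then
      (∏ k, quadWeight L β (κ k)) * F (fun k => resA L (κ k)) else 0 := by
  rw [Finset.sum_eq_single (fun k => resA L (κ k))]
  · by_cases hc : ∀ k : Fin 4, resB L (κ k) = resA L (κ (k + 1))
    · have hp : (∏ k, if resA L (κ k) = (fun k => resA L (κ k)) k ∧
          resB L (κ k) = (fun k => resA L (κ k)) (k + 1) then quadWeight L β (κ k) else 0) =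
          ∏ k, quadWeight L β (κ k) :=
        Finset.prod_congr rfl fun k _ => if_pos ⟨rfl, hc k⟩
      rw [if_pos hc, hp]
    · rw [if_neg hc]
      obtain ⟨k, hk⟩ := not_forall.1 hc
      rw [Finset.prod_eq_zero (Finset.mem_univ k) (if_neg fun h => hk h.2), zero_mul]
  · intro s _ hs
    obtain ⟨k, hk⟩ : ∃ k, s k ≠ resA L (κ k) := by
      by_contra h
      push Not at h
      exact hs (funext h)
    rw [Finset.prod_eq_zero (Finset.mem_univ k) (if_neg fun h => hk h.1.symm), zero_mul]
  · intro h; exact absurd (Finset.mem_univ _) h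

/-- **Corner-transfer-matrix trace formula** (Baxter 1976, in `ℤ³` about the `x₂`-axis): for every
function `F` of the four wall configurations `(ω ∘ Rᵏ)|_P`,
`∑_τ w(τ) F(walls of τ) = ∑_{s₀,…,s₃} ctm s₀ s₁ · ctm s₁ s₂ · ctm s₂ s₃ · ctm s₃ s₀ · F(s)`. [folklore] -/
theorem sum_isingWeight_mul_eq (F : (Fin 4 → (↥(wallP L) → ℤˣ)) → ℝ) :
    ∑ τ : ↥(box 3 L) → ℤˣ, isingWeight (zdGraph 3) (box 3 L) β 0 .plus τ * F (fun k : Fin 4 => wallRes L k τ) =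
    ∑ s : Fin 4 → (↥(wallP L) → ℤˣ), (∏ k, ctm L β (s k) (s (k + 1))) * F s := by
  -- expand the product of corner transfer matrices into a sum over quadruples
  have hexp : ∀ s : Fin 4 → (↥(wallP L) → ℤˣ), (∏ k, ctm L β (s k) (s (k + 1))) =
      ∑ κ : Fin 4 → (↥(quadQ L) → ℤˣ),
        ∏ k, if resA L (κ k) = s k ∧ resB L (κ k) = s (k + 1) then quadWeight L β (κ k) else 0 := by
    intro s
    simp_rw [ctm_apply]
    exact Fintype.prod_sum (fun k κ => if resA L κ = s k ∧ resB L κ = s (k + 1) then quadWeight L β κ else 0)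
  simp_rw [hexp, Finset.sum_mul]
  rw [Finset.sum_comm]
  simp_rw [sum_prod_ite_mul, ← Finset.sum_filter]
  rw [← compatSet, ← sum_eq_sum_compatSet]
  refine Finset.sum_congr rfl fun τ _ => ?_
  rw [isingWeight_eq_prod_quadWeight]
  rfl

/-- Sums over `Fin 4 → α` as fourfold iterated sums. [folklore] -/
theorem sum_fin_four_pi {α M : Type*} [Fintype α] [AddCommMonoid M] (f : (Fin 4 → α) → M) :
    ∑ s, f s = ∑ a, ∑ b, ∑ c, ∑ d, f ![a, b, c, d] := by
  have step : ∀ (n : ℕ) (h : (Fin (n + 1) → α) → M),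
      ∑ s, h s = ∑ a, ∑ t : Fin n → α, h (Fin.cons a t) := by
    intro n h
    rw [← (Fin.consEquiv fun _ : Fin (n + 1) => α).sum_comp, Fintype.sum_prod_type]
    rfl
  rw [step]
  refine Finset.sum_congr rfl fun a _ => ?_
  rw [step]
  refine Finset.sum_congr rfl fun b _ => ?_
  rw [step]
  refine Finset.sum_congr rfl fun c _ => ?_
  rw [step]
  refine Finset.sum_congr rfl fun d _ => ?_
  rw [Fintype.sum_unique]
  rfl

/-- **Trace of a four-cycle**: for a square matrix `N` and diagonal insertions `g₀,…,g₃`,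
`Tr (D₀ N D₁ N D₂ N D₃ N) = ∑_s (∏_k N (s k) (s (k+1))) ∏_k g_k (s k)`. [folklore] -/
theorem trace_four_cycle {ι : Type*} [Fintype ι] [DecidableEq ι] (N : Matrix ι ι ℝ) (g : Fin 4 → ι → ℝ) :
    Matrix.trace (Matrix.diagonal (g 0) * N * Matrix.diagonal (g 1) * N * Matrix.diagonal (g 2) * N *
      Matrix.diagonal (g 3) * N) =
    ∑ s : Fin 4 → ι, (∏ k, N (s k) (s (k + 1))) * ∏ k, g k (s k) := by
  have hP : ∀ k, Matrix.diagonal (g k) * N = Matrix.of (fun i j => g k i * N i j) := fun k => by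
    ext i j; simp [Matrix.diagonal_mul]
  rw [show Matrix.diagonal (g 0) * N * Matrix.diagonal (g 1) * N * Matrix.diagonal (g 2) * N *
      Matrix.diagonal (g 3) * N = (Matrix.diagonal (g 0) * N) * ((Matrix.diagonal (g 1) * N) *
      ((Matrix.diagonal (g 2) * N) * (Matrix.diagonal (g 3) * N))) by simp only [Matrix.mul_assoc]]
  simp only [hP, Matrix.trace, Matrix.diag, Matrix.mul_apply, Matrix.of_apply, Finset.mul_sum]
  rw [sum_fin_four_pi]
  simp only [Fin.prod_univ_four, Fin.isValue, Matrix.cons_val_zero, Matrix.cons_val_one, Matrix.cons_val,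
    show ((3 : Fin 4) + 1) = 0 from rfl, show ((2 : Fin 4) + 1) = 3 from rfl,
    show ((1 : Fin 4) + 1) = 2 from rfl, show ((0 : Fin 4) + 1) = 1 from rfl]
  refine Finset.sum_congr rfl fun a _ => Finset.sum_congr rfl fun b _ =>
    Finset.sum_congr rfl fun c _ => Finset.sum_congr rfl fun d _ => ?_
  ring

/-- The indicator of a prescribed spin at a site is a measurable observable. [folklore] -/
theorem measurable_ite_apply_eq (x : Site 3) (u : ℤˣ) :
    Measurable fun ω : SpinConfig (Site 3) => if ω x = u then (1:ℝ) else 0 :=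
  (Measurable.of_discrete (f := fun s : ℤˣ => if s = u then (1:ℝ) else 0)).comp (measurable_pi_apply x)

/-- An observable of the spins on a finite set of sites, read off through a relabelling, is measurable.
[folklore] -/
theorem measurable_comp_restrict (S : Finset (Site 3)) (r : ↥S → Site 3) (g : (↥S → ℤˣ) → ℝ) :
    Measurable fun ω : SpinConfig (Site 3) => g (fun x => ω (r x)) :=
  (measurable_of_finite g).comp (measurable_pi_lambda _ fun x => measurable_pi_apply (r x))

end

end Summit.CriticalPhenomena.Ising3DConformalLimit.QuarterTurnCTM
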